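import Mathlib

/-!
# SoloBlindTorelliQ8 — a Torelli automorphism of `π₁(Σ₃)` moves a quaternionic structure

Solo programme `solo-HodgeConjecture-blind`, session s54 (THEOREM LEVEL / LEMMA TI,
`work/s54/prym-side.md`).

Setting. `π₁(Σ₃) = ⟨a₁,b₁,a₂,b₂,a₃,b₃ ∣ R⟩`, `R = [a₁,b₁][a₂,b₂][a₃,b₃]`, generators indexed
`0=a₁, 1=b₁, 2=a₂, 3=b₂, 4=a₃, 5=b₃`.  A *quaternionic structure* is the `Aut Q₈`-class of an
epimorphism `π₁(Σ₃) ↠ Q₈`; the mapping class group `Mod₃ = Out⁺(π₁Σ₃)` (Dehn–Nielsen–Baer) permutes the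
5040 structures, and this permutation action is the monodromy of the cover `M₃(Q₈) → M₃` on which the
quaternionic Prym map to the orthogonal Shimura variety is defined.

We certify, by `decide` and three lines of rewriting, that this action does **not** factor through
`Sp₆(ℤ)`: the substitution

  `BP : a₁ ↦ u a₁ u⁻¹,  b₁ ↦ u b₁ u⁻¹,  b₂ ↦ a₂⁻¹ [b₃,a₃] b₂ a₂,  a₂, a₃, b₃ fixed,  u = [b₃,a₃] a₂⁻¹`

(found as the Dehn-reduced form of the genus-1 bounding-pair map `(T_{a₁}T_{b₁}T_{c₁₂})⁴ T_{a₂}^{-2}`;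
this provenance is not used) satisfies

* `BP_rel`  : `BP(R) = w R w⁻¹` in the free group `F₆` (`w = [b₃,a₃]a₂⁻¹`), and `BP_inv` : `BP` has the
  two-sided inverse `BPinv` on generators — so `BP` induces an orientation-preserving automorphism of
  `π₁(Σ₃)`, i.e. a mapping class;
* `BP_torelli` : the abelianisation of `BP` is the identity (`a_k ↦ a_k` in `H₁(Σ₃;ℤ) = ℤ⁶`) — so that
  mapping class lies in the Torelli group `I₃`;
* `rho_relator`, `rho_onto` : `ρ = (1, i, j, 1, 1, i)` is an epimorphism `π₁(Σ₃) ↠ Q₈`;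
* `BP_act` : `ρ ∘ BP = (1, i⁻¹, j, 1, 1, i)`;
* `BP_moves_class` : there is no self-map `σ : Q₈ → Q₈` at all with `σ ∘ ρ = ρ ∘ BP` (because
  `ρ(b₁) = ρ(b₃) = i` but `(ρ∘BP)(b₁) = i⁻¹ ≠ i = (ρ∘BP)(b₃)`); in particular `ρ` and `ρ ∘ BP` are not
  `Aut Q₈`-equivalent.

Consequence (LEMMA TI of the write-up): the Torelli group acts non-trivially on quaternionic structures of
genus 3, so `M₃(Q₈) → M₃` is not the pull-back of any level cover of `A₃`.  (The full structure — the
image of `Mod₃` has order `2³⁵·|Sp₆(𝔽₂)|`, its level-2 part is `H₁(Mod₃[2];𝔽₂) ≅ 𝔽₂³⁵`, the Torelli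
group acts through the mod-2 Johnson homomorphism with image `𝔽₂¹⁴`, the Johnson kernel acts trivially —
is certified outside Lean: `work/s54/torelli_level*.log`, GAP job j188881.)
-/

namespace Summit.HodgeConjecture.HodgeConjecture.Theorems.TorelliQ8

set_option maxHeartbeats 4000000
set_option maxRecDepth 4000

/-- Words in six generators `0=a₁, 1=b₁, 2=a₂, 3=b₂, 4=a₃, 5=b₃`; `(k,true)` is the generator,
`(k,false)` its inverse (the `FreeGroup.mk` convention). -/
abbrev W := List (Fin 6 × Bool)

/-- Formal inverse of a word. -/
def winv (l : W) : W := (l.map fun p => (p.1, !p.2)).reverse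

/-- A substitution: generator ↦ word. -/
abbrev Subst := Fin 6 → W

/-- Apply a substitution to a word. -/
def subst (φ : Subst) (l : W) : W := l.flatMap fun p => if p.2 then φ p.1 else winv (φ p.1)

/-- The surface relator `R = [a₁,b₁][a₂,b₂][a₃,b₃]`. -/
def R : W := [(0,true),(1,true),(0,false),(1,false),(2,true),(3,true),(2,false),(3,false),
  (4,true),(5,true),(4,false),(5,false)]

/-- The word `u = b₃ a₃ b₃⁻¹ a₃⁻¹ a₂⁻¹ = [b₃,a₃] a₂⁻¹`. -/
def u : W := [(5,true),(4,true),(5,false),(4,false),(2,false)]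

/-- The Torelli substitution `BP`: `a₁ ↦ u a₁ u⁻¹`, `b₁ ↦ u b₁ u⁻¹`, `b₂ ↦ a₂⁻¹[b₃,a₃]b₂a₂`, rest fixed. -/
def BP : Subst := fun k =>
  if k = 0 then u ++ [(0,true)] ++ winv u
  else if k = 1 then u ++ [(1,true)] ++ winv u
  else if k = 3 then [(2,false),(5,true),(4,true),(5,false),(4,false),(3,true),(2,true)]
  else [(k,true)]

/-- Its inverse: `a₁ ↦ u⁻¹ a₁ u`, `b₁ ↦ u⁻¹ b₁ u`, `b₂ ↦ [a₃,b₃] a₂ b₂ a₂⁻¹`, rest fixed. -/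
def BPinv : Subst := fun k =>
  if k = 0 then winv u ++ [(0,true)] ++ u
  else if k = 1 then winv u ++ [(1,true)] ++ u
  else if k = 3 then [(4,true),(5,true),(4,false),(5,false),(2,true),(3,true),(2,false)]
  else [(k,true)]

/-- The class of a word in the free group `F₆`. -/
abbrev fg (l : W) : FreeGroup (Fin 6) := FreeGroup.mk l

/-! ## `BP` is an orientation-preserving automorphism of the surface group, trivial on homology -/

/-- `BP(R) = u R u⁻¹` in `F₆`: `BP` preserves the relator up to conjugacy (with the same orientation). -/
theorem BP_rel : fg (subst BP R) = fg u * fg R * (fg u)⁻¹ := by decide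

/-- `BP` is an automorphism of `F₆`: two-sided inverse `BPinv` on generators. -/
theorem BP_inv : ∀ k : Fin 6,
    fg (subst BP (BPinv k)) = FreeGroup.of k ∧ fg (subst BPinv (BP k)) = FreeGroup.of k := by
  decide

/-- Exponent sum of the generator `m` in a word (the `m`-th coordinate of its abelianisation). -/
def expSum (m : Fin 6) (l : W) : ℤ :=
  (l.map fun p => if p.1 = m then (if p.2 then (1 : ℤ) else -1) else 0).sum

/-- TORELLI: `BP` induces the identity on `H₁(Σ₃;ℤ) = ℤ⁶` (abelianisation of every image is the
corresponding basis vector). -/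
theorem BP_torelli : ∀ k m : Fin 6, expSum m (BP k) = if k = m then 1 else 0 := by decide

/-! ## The quaternionic structure `ρ = (1,i,j,1,1,i)` and its image under `BP` -/

/-- `Q₈`. -/
abbrev Q := QuaternionGroup 2
/-- `i = a 1`. -/
def qi : Q := QuaternionGroup.a 1
/-- `j = xa 0`. -/
def qj : Q := QuaternionGroup.xa 0

/-- Evaluate a word under an assignment of the generators in a group. -/
def evalW {G : Type*} [Group G] (ρ : Fin 6 → G) (l : W) : G :=
  (l.map fun p => if p.2 then ρ p.1 else (ρ p.1)⁻¹).prod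

/-- Precomposition of an assignment with a substitution: `k ↦ ρ(φ k)`. -/
def act (φ : Subst) (ρ : Fin 6 → Q) : Fin 6 → Q := fun k => evalW ρ (φ k)

/-- `ρ = (a₁,b₁,a₂,b₂,a₃,b₃) ↦ (1, i, j, 1, 1, i)`. -/
def rho : Fin 6 → Q := fun k => if k = 1 then qi else if k = 2 then qj else if k = 5 then qi else 1

/-- `ρ' = (1, i⁻¹, j, 1, 1, i)`. -/
def rho' : Fin 6 → Q := fun k => if k = 1 then qi⁻¹ else if k = 2 then qj else if k = 5 then qi else 1

/-- `ρ` kills the relator, so it is a homomorphism `π₁(Σ₃) → Q₈`. -/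
theorem rho_relator : evalW rho R = 1 := by decide

/-- `ρ` is onto `Q₈`: every element is `i^m j^e` with `i = ρ(b₁)`, `j = ρ(a₂)`. -/
theorem rho_onto : ∀ g : Q, ∃ m : Fin 4, ∃ e : Bool,
    g = (rho 1) ^ (m : ℕ) * (if e then rho 2 else 1) := by decide

/-- `ρ ∘ BP = ρ'`. -/
theorem BP_act : act BP rho = rho' := by decide

/-- `ρ'` also kills the relator (it must: `BP` preserves `R` up to conjugacy). -/
theorem rho'_relator : evalW rho' R = 1 := by decide

/-- NO self-map of `Q₈` carries `ρ` to `ρ ∘ BP`: `ρ(b₁) = ρ(b₃) = i` while `ρ'(b₁) = i⁻¹ ≠ i = ρ'(b₃)`.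
In particular the quaternionic structures `[ρ]` and `[ρ ∘ BP]` (classes modulo `Aut Q₈`) are different:
the Torelli automorphism `BP` moves a quaternionic structure. -/
theorem BP_moves_class (σ : Q → Q) : ¬ (∀ k : Fin 6, σ (rho k) = act BP rho k) := by
  intro h
  have h1 := h 1
  have h5 := h 5
  rw [BP_act] at h1 h5
  have e1 : rho 1 = qi := by decide
  have e5 : rho 5 = qi := by decide
  have f1 : rho' 1 = qi⁻¹ := by decide
  have f5 : rho' 5 = qi := by decide
  rw [e1, f1] at h1
  rw [e5, f5] at h5
  have hq : qi⁻¹ = qi := h1.symm.trans h5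
  exact absurd hq (by decide)

/-- Control: the square of the Dehn twist `t_{a₁}` (`b₁ ↦ b₁a₁²`), a generator of the level-2 group
`Mod₃[2]`, FIXES this particular structure (`ρ(a₁) = 1`), while it moves others (LiftTorsor): the
action of `Mod₃[2]` on structures is by translations of each 16-element torsor, plane by plane. -/
def A1sq : Subst := fun k => if k = 1 then [(1,true),(0,true),(0,true)] else [(k,true)]

/-- `t_{a₁}²` fixes `ρ` on the nose. -/
theorem A1sq_fixes_rho : act A1sq rho = rho := by decide

end Summit.HodgeConjecture.HodgeConjecture.Theorems.TorelliQ8
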